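import Literature.NumberTheory.QuadraticFields.RedeiReichardtFourRank
import Literature.NumberTheory.QuadraticFields.FourRankOneKernelCriterion
import Literature.NumberTheory.QuadraticFields.RingClassGroupTower
import HarnessLib

/-!
# Rédei–Reichardt for the order of conductor `2`: the `4`-rank of `Pic(𝒪₂) = C(−16n)` of `ℚ(√−n)`,
# `n ≡ 1 (mod 4)`, is `#{e ∈ 𝔽₂^t : RM(D)ᵀ e = 0, e₂ = 0}` — the Rédei kernel with the prime `2` deleted

Topic `NumberTheory/QuadraticFields`, namespace `Literature.NumberTheory.QuadraticFields.RedeiReichardt`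
(sequel of `RedeiReichardtFourRank.lean`, which proves `#(Cl² ∩ Cl[2]) = #{e : RM(D)ᵀ e = 0}/2 = 2^{t−1−rank RM(D)}`
for the MAXIMAL order, and of `FourRankOneKernelCriterion.lean`).  THEOREMS ONLY: no definition, no named
fact, no `sorry` (D-0026; net Literature debt 0).  Cell `bsd-print-cf2`, seat `bsd-print-cf2-ty2` (typer).

## What is proved

Let `K ∋ x = √−n` be imaginary quadratic, `n ≡ 1 (mod 4)` square-free, `n ≠ 1`, so `d_K = −4n`, the primes
of `d_K` are `p₁, …, p_t` with `∏ pᵢ = 2n` (one of them, `p_{i₂}`, is `2`), `𝔭ᵢ² = (pᵢ)` the ramified primes,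
and `RM(D)` the tree's Rédei matrix (`redeiMatrix n p`, Li–Ma Def. 0.2).  Let `Pic(𝒪₂) = I_K(2)/P_{K,ℤ}(2)`
(`RingClass.RingClassGroup K 2`; `≅ C(𝒪₂) = C(−16n)`, Cox Prop. 7.22) with its surjection
`π : Pic(𝒪₂) → Cl(𝒪_K)` (Cox (7.25)), whose kernel `{1, κ}` has order `2` (Cox Thm. 7.24: `h(−16n) = 2h(−4n)`).
ASSUME `κ` is a square in `Pic(𝒪₂)` (it always is here — `κ = [(n, 0, 4)]` lies in the principal genus of
discriminant `−16n` — but we take it as a hypothesis, discharged by the consumer from its display).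

§1 (group theory of `1 → {1, κ} → G —π→ C → 1`, `κ ≠ 1` a square; finite abelian groups):
`#G = 2·#C` (`natCard_eq_two_mul_of_ker_pair`), `g ∈ G² ⟺ π(g) ∈ C²` (`isSquare_iff_isSquare_map_of_ker_pair`),
`#G² = 2·#C²` (`natCard_isSquare_eq_two_mul_of_ker_pair`), hence **`#G[2] = #C[2]`**
(`natCard_sq_eq_one_eq_of_ker_pair`; `#G = #G²·#G[2]`, first isomorphism theorem for `g ↦ g²`).

§2 (the order of conductor `2`):
* `sup_span_two_eq_top_of_ne_two` — `𝔭ⱼ + 2𝒪_K = 𝒪_K` for `pⱼ` odd, so `[𝔭ⱼ] ∈ I_K(2)/P_{K,ℤ}(2)` makes sense;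
* `prod_filter_dvd_eq_span` — `∏_{pⱼ ∣ n} 𝔭ⱼ = (x)` (any `n`);
* `prin_sqrt_neg_not_mem_ringClassDen_two` — **`(x) = √−n·𝒪_K ∉ P_{K,ℤ}(2)`** for `n ≡ 1 (mod 4)`, `n ≠ 1`:
  otherwise `x ≡ ±a (mod 2𝒪_K)` with `a` odd (Cox (7.27) / Exercise 7.30, the tree's
  `exists_units_int_of_prin_mem_ringClassDen`; `𝒪_K^× = {±1}`), and `x = a + 2z` gives `−n = a² + 4(az + z²)`,
  `4 ∣ n + a²`, impossible for `n ≡ 1 (mod 4)`, `a` odd.  So `κ := [(x)]` IS the non-trivial kernel element.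
* `fourTwoCard_ringClassGroup_two_eq_card` — **THE COUNT**:
  `fourTwoCard (Pic(𝒪₂)) = #(Pic(𝒪₂)² ∩ Pic(𝒪₂)[2]) = #{e ∈ 𝔽₂^t : RM(D)ᵀ e = 0 ∧ e_{i₂} = 0}`.
  Proof (Stevenhagen's method, §2, run in `Pic(𝒪₂)`): the classes `yⱼ = [𝔭ⱼ] ∈ Pic(𝒪₂)` (`pⱼ` odd) are
  involutions (`𝔭ⱼ² = pⱼ𝒪_K ∈ P_{K,ℤ}(2)`) lifting `[𝔭ⱼ] ∈ Cl(𝒪_K)`; `ψ(e) = ∏ yⱼ^{eⱼ}` on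
  `E = {e : e_{i₂} = 0}` is INJECTIVE (a relation forces `∏ 𝔭ⱼ^{eⱼ}` principal, so `e ∈ {0, r}` by the tree's
  `eq_zero_or_eq_indicator_of_isPrincipal`, and `ψ(r) = [(x)] ≠ 1` by the previous bullet), hence BIJECTIVE onto
  `Pic(𝒪₂)[2]` (`#E = 2^{t−1} = #Cl[2] = #Pic(𝒪₂)[2]` by §1 and Gauss, the tree's `natCard_sq_eq_one_eq`); and
  `ψ(e)` is a square iff `π ψ(e) = ∏ [𝔭ⱼ]^{eⱼ}` is a square in `Cl(𝒪_K)` (§1) iff `RM(D)ᵀ e = 0` (the tree's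
  `isSquare_prod_pow_iff` + `redeiMatrix_transpose_apply`: genus characters and quadratic reciprocity).
* `fourTwoCard_ringClassGroup_two_eq_card_of_isQuadraticFieldOfSqrt` — the same with the field given as
  `IsQuadraticFieldOfSqrt K (−n)` (the ramified primes chosen inside the proof).

So **`r₄(C(−16n)) = t − 1 − rank_{𝔽₂}(RM(D)ᵀ with the column of 2 deleted… )`**, precisely
`2^{r₄(C(−16n))} = #ker(RM(D)ᵀ) ∩ {e_{i₂} = 0}`, while `2^{r₄(C(−4n))+1} = #ker(RM(D)ᵀ)` (tree): the two
`4`-ranks differ by at most one, and `r₄(−16n) = r₄(−4n)` iff some kernel vector has `e_{i₂} = 1`.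

## Why (the consumer)

With `Summits/BirchSwinnertonDyer/Rank1Residual/P2/PrintCf2GenusPeriodMoverFourRank.lean`
(`exists_mover_iff_fourTwoCard_eq_two`: the Tian–Yuan–Zhang genus period `Z(d)`, `d ≡ 5 (mod 8)`, is MOVED by
an automorphism trivial on the genus field iff `fourTwoCard (Pic(𝒪₂)(ℚ(√−d))) = 2`) the mover question — the
LEAD note `offtyz_v7_QForm.md` §2 (2a) «`c^Z_d ≠ 0 ⟺ e₄(−16d) = 1`» — becomes the finite linear-algebra
statement `#{e : RM(−4d)ᵀ e = 0, e₂ = 0} = 2`, decidable per family by `decide` exactly like the tree's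
Rédei certificates (`RedeiMatrixFourRank.lean` §4–5).  Nothing here is specific to elliptic curves; BSD is not
proved by any of this.

## References

* [RedeiReichardt1934] L. Rédei, H. Reichardt, *Die Anzahl der durch 4 teilbaren Invarianten der Klassengruppe
  eines beliebigen quadratischen Zahlkörpers*, J. reine angew. Math. 170 (1934), 69–74.
* [Stevenhagen1995RedeiMatrices] P. Stevenhagen, *Rédei-matrices and applications*, LMS LNS 215 (1995), §2
  Thm. 1 and its proof (ambiguous ideals, genus characters, `2^{r₄} = #(C² ∩ C[2])`).
* [LiMa2008] Y. Li, L. Ma, Acta Arith. 134 (2008), Lemma 0.1, Def. 0.2, Thm. 0.4 (the matrix `RM(D)`).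
* [Cox2013] D. A. Cox, *Primes of the form x² + ny²*, 2nd ed. (2013), §7.C Prop. 7.22 (`C(𝒪) ≅ I_K(f)/P_{K,ℤ}(f)`),
  §7.D Thm. 7.24, (7.25)–(7.27), Exercise 7.30.
* [Buell1989] D. A. Buell, *Binary Quadratic Forms*, Springer (1989), Thm. 4.16, Prop. 4.17, Thm. 4.21
  (PDF pp. 37–40: genera, ambiguous classes and the principal genus `=` squares, for ARBITRARY discriminants —
  here `−16n`), Thm. 9.1 (PDF p. 84).
* [Rotman1995] J. J. Rotman, *An Introduction to the Theory of Groups*, 4th ed. (1995), Thm. 2.24 (PDF p. 43: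
  first isomorphism theorem) — the counting of §1.

## Mathlib / tree search

Tree (reused, never restated): `RedeiReichardt.{exists_sq_eq_span, natCard_sq_eq_one_eq,
eq_zero_or_eq_indicator_of_isPrincipal, isSquare_prod_pow_iff, redeiMatrix_transpose_apply,
forall_sum_eq_zero_of_odd, prod_span_pair_eq_span, eq_of_sq_eq_span_of_mem, units_eq_one_or_neg_one, discr_eq,
exists_ringOfIntegers_sq_eq_neg}`, `RingClass.{RingClassGroup, ringClassNum, ringClassDen, toClassGroup,
toClassGroup_mk, prin, coe_prin', prin_mem_ringClassDen, mk0_mem_ringClassNum, span_sup_eq_top_of_sub_mem,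
exists_units_int_of_prin_mem_ringClassDen, intCast_mem_span_iff, finite_ringClassGroup}`,
`FourRankOne.{toClassGroup_surjective_of_discr_neg, toClassGroup_two_eq_one_iff}`, `Tian2014.fourTwoCard`.
The lemma `#G = #G²·#G[2]` is the tree's `Tian2014…CMPointSystemDescentPrimeBase.natCard_eq_card_isSquare_mul_card_sq_eq_one`
(not imported: that module is heavy); a private copy is used.  Mathlib: `QuotientGroup.mk'`, `QuotientGroup.eq_one_iff`,
`Subgroup.index_ker`, `Subgroup.card_mul_index`, `ClassGroup.mk_mk0`, `ClassGroup.mk0_eq_one_iff`,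
`Function.Injective.bijective_of_nat_card_le`, `Nat.card_eq_of_bijective`.
-/

noncomputable section

open NumberField Ideal Module Matrix
open scoped nonZeroDivisors

namespace Literature.NumberTheory.QuadraticFields.RedeiReichardt

open Literature.NumberTheory.QuadraticFields.Quadratic
open Literature.NumberTheory.QuadraticFields.RingClass
open Literature.NumberTheory.QuadraticFields.FourRankOne
open Literature.NumberTheory.EllipticCurves.Tian2014 (IsQuadraticFieldOfSqrt fourTwoCard fourTwoCard_def)

/-! ## §1 Finite abelian extensions `1 → {1, κ} → G → C → 1` with `κ` a square -/

section KerPair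

variable {G C : Type*} [CommGroup G] [CommGroup C]
  (π : G →* C) (hπ : Function.Surjective π) {κ : G} (hker : ∀ g : G, π g = 1 ↔ g = 1 ∨ g = κ)

/-- `#G = #G² · #G[2]` for a finite abelian group (first isomorphism theorem for `g ↦ g²`); a private copy
of the tree's `Tian2014…natCard_eq_card_isSquare_mul_card_sq_eq_one`. [cite: Rotman1995, Thm. 2.24 (PDF p. 43)] -/
private theorem natCard_eq_natCard_isSquare_mul (A : Type*) [CommGroup A] [Finite A] :
    Nat.card A = Nat.card {a : A // IsSquare a} * Nat.card {a : A // a ^ 2 = 1} := by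
  let f : A →* A := powMonoidHom 2
  have h1 : Nat.card A = Nat.card (A ⧸ f.ker) * Nat.card f.ker :=
    Subgroup.card_eq_card_quotient_mul_card_subgroup f.ker
  have h2 : Nat.card (A ⧸ f.ker) = Nat.card f.range :=
    Nat.card_congr (QuotientGroup.quotientKerEquivRange f).toEquiv
  have h3 : Nat.card f.range = Nat.card {a : A // IsSquare a} := by
    refine Nat.card_congr (Equiv.subtypeEquivRight fun a => ?_)
    rw [MonoidHom.mem_range]
    constructor
    · rintro ⟨y, hy⟩
      exact ⟨y, by rw [← hy, powMonoidHom_apply, sq]⟩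
    · rintro ⟨r, hr⟩
      exact ⟨r, by rw [powMonoidHom_apply, sq, hr]⟩
  have h4 : Nat.card f.ker = Nat.card {a : A // a ^ 2 = 1} :=
    Nat.card_congr (Equiv.subtypeEquivRight fun c => by rw [MonoidHom.mem_ker, powMonoidHom_apply])
  rw [h1, h2, h3, h4]

include hπ hker in
/-- **`#G = 2 · #C`** when `π : G ↠ C` has kernel `{1, κ}`, `κ ≠ 1` (`#G = #ker π · #im π`).
[cite: Rotman1995, Thm. 2.24 (PDF p. 43)] [cite: Cox2013, §7.D Thm. 7.24 and (7.27)] -/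
theorem natCard_eq_two_mul_of_ker_pair (hκ1 : κ ≠ 1) : Nat.card G = 2 * Nat.card C := by
  have hk : Nat.card π.ker = 2 := by
    rw [Nat.card_eq_two_iff]
    refine ⟨1, ⟨κ, by rw [MonoidHom.mem_ker]; exact (hker κ).mpr (Or.inr rfl)⟩, ?_, ?_⟩
    · intro h
      exact hκ1 (by simpa using (congrArg Subtype.val h).symm)
    · ext z
      simp only [Set.mem_insert_iff, Set.mem_singleton_iff, Set.mem_univ, iff_true]
      rcases (hker z.1).mp (MonoidHom.mem_ker.mp z.2) with h | h
      · exact Or.inl (Subtype.ext (by simpa using h))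
      · exact Or.inr (Subtype.ext (by simpa using h))
  have hr : Nat.card π.range = Nat.card C := by
    rw [MonoidHom.range_eq_top.mpr hπ, Subgroup.card_top]
  have h := π.ker.card_mul_index
  rw [Subgroup.index_ker, hk, hr] at h
  exact h.symm

include hπ hker in
/-- **`G² = π⁻¹(C²)`** when `ker π = {1, κ}` with `κ` a SQUARE: `g` is a square iff `π(g)` is (if
`π(g) = π(r)²` then `g ∈ r²·{1, κ} ⊆ G²`). [cite: Rotman1995, Thm. 2.24 (PDF p. 43)]
[cite: Buell1989, Thm. 4.21 (PDF p. 40: the principal genus is the subgroup of squares)] -/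
theorem isSquare_iff_isSquare_map_of_ker_pair (hκsq : IsSquare κ) (g : G) :
    IsSquare g ↔ IsSquare (π g) := by
  constructor
  · rintro ⟨r, rfl⟩
    exact ⟨π r, map_mul π r r⟩
  · rintro ⟨c, hc⟩
    obtain ⟨r, rfl⟩ := hπ c
    have h1 : π (g * (r * r)⁻¹) = 1 := by rw [map_mul, map_inv, map_mul, hc, mul_inv_cancel]
    rcases (hker _).mp h1 with h | h
    · exact ⟨r, mul_inv_eq_one.mp h⟩
    · obtain ⟨s, hs⟩ := hκsq
      refine ⟨s * r, ?_⟩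
      rw [mul_inv_eq_iff_eq_mul.mp h, hs, mul_mul_mul_comm]

include hπ hker in
/-- **`#G² = 2 · #C²`** when `ker π = {1, κ}`, `κ ≠ 1` a square (`π|_{G²} : G² ↠ C²` has kernel `{1, κ}`).
[cite: Rotman1995, Thm. 2.24 (PDF p. 43)] [cite: Stevenhagen1995RedeiMatrices, §2 (proof of Thm. 1)] -/
theorem natCard_isSquare_eq_two_mul_of_ker_pair (hκ1 : κ ≠ 1) (hκsq : IsSquare κ) :
    Nat.card {g : G // IsSquare g} = 2 * Nat.card {c : C // IsSquare c} := by
  have hπκ : π κ = 1 := (hker κ).mpr (Or.inr rfl)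
  set S : Subgroup G := (powMonoidHom 2 : G →* G).range with hSdef
  have hmemS : ∀ g : G, g ∈ S ↔ IsSquare g := fun g => by
    rw [hSdef, MonoidHom.mem_range]
    constructor
    · rintro ⟨r, hr⟩
      exact ⟨r, by rw [← hr, powMonoidHom_apply, pow_two]⟩
    · rintro ⟨r, hr⟩
      exact ⟨r, by rw [powMonoidHom_apply, pow_two, hr]⟩
  have hκS : κ ∈ S := (hmemS κ).mpr hκsq
  let ψ : S →* C := π.comp S.subtype
  have hψapply : ∀ s : S, ψ s = π s := fun s => rfl
  have hψker : Nat.card ψ.ker = 2 := by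
    rw [Nat.card_eq_two_iff]
    refine ⟨1, ⟨⟨κ, hκS⟩, by rw [MonoidHom.mem_ker, hψapply]; exact hπκ⟩, ?_, ?_⟩
    · intro h
      have h' := congrArg (fun z : ψ.ker => ((z : S) : G)) h
      exact hκ1 (by simpa using h'.symm)
    · ext z
      simp only [Set.mem_insert_iff, Set.mem_singleton_iff, Set.mem_univ, iff_true]
      have hz : π ((z : S) : G) = 1 := by rw [← hψapply]; exact z.2
      rcases (hker _).mp hz with h | h
      · exact Or.inl (Subtype.ext (Subtype.ext (by simpa using h)))
      · exact Or.inr (Subtype.ext (Subtype.ext (by simpa using h)))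
  have hψrange : Nat.card ψ.range = Nat.card {c : C // IsSquare c} := by
    refine Nat.card_congr (Equiv.subtypeEquivRight fun c => ?_)
    rw [MonoidHom.mem_range]
    constructor
    · rintro ⟨⟨s, hs⟩, rfl⟩
      obtain ⟨r, hr⟩ := (hmemS s).mp hs
      exact ⟨π r, by rw [hψapply]; change π s = _; rw [hr, map_mul]⟩
    · rintro ⟨r, hr⟩
      obtain ⟨y, rfl⟩ := hπ r
      exact ⟨⟨y * y, (hmemS _).mpr ⟨y, rfl⟩⟩, by rw [hψapply]; change π (y * y) = _; rw [hr, map_mul]⟩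
  have hcardS : Nat.card S = 2 * Nat.card {c : C // IsSquare c} := by
    have h := ψ.ker.card_mul_index
    rw [Subgroup.index_ker, hψker, hψrange] at h
    exact h.symm
  rw [← hcardS]
  exact Nat.card_congr (Equiv.subtypeEquivRight fun g => (hmemS g).symm)

include hπ hker in
/-- **`#G[2] = #C[2]`** when `ker π = {1, κ}`, `κ ≠ 1` a square: `#G = 2#C`, `#G² = 2#C²`, and
`#A = #A²·#A[2]` for `A = G, C`.  (For `G = Pic(𝒪₂) → C = Cl(𝒪_K)`, `d_K = −4n`: both counts are `2^{t−1}`, the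
number of ambiguous classes of discriminants `−16n` and `−4n`.) [cite: Rotman1995, Thm. 2.24 (PDF p. 43)]
[cite: Buell1989, Prop. 4.17 (PDF p. 37: the number of ambiguous classes, any discriminant)] -/
theorem natCard_sq_eq_one_eq_of_ker_pair [Finite G] [Finite C] (hκ1 : κ ≠ 1) (hκsq : IsSquare κ) :
    Nat.card {g : G // g ^ 2 = 1} = Nat.card {c : C // c ^ 2 = 1} := by
  have hG := natCard_eq_natCard_isSquare_mul G
  have hC := natCard_eq_natCard_isSquare_mul C
  rw [natCard_eq_two_mul_of_ker_pair π hπ hker hκ1, natCard_isSquare_eq_two_mul_of_ker_pair π hπ hker hκ1 hκsq,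
    hC] at hG
  have hpos : 0 < 2 * Nat.card {c : C // IsSquare c} :=
    Nat.mul_pos two_pos (Nat.card_pos_iff.mpr ⟨⟨⟨1, ⟨1, (mul_one 1).symm⟩⟩⟩, inferInstance⟩)
  have h' : 2 * Nat.card {c : C // IsSquare c} * Nat.card {c : C // c ^ 2 = 1} =
      2 * Nat.card {c : C // IsSquare c} * Nat.card {g : G // g ^ 2 = 1} := by
    rw [← hG]; ring
  exact (Nat.eq_of_mul_eq_mul_left hpos h').symm

end KerPair

/-! ## §2 The ring class group of conductor `2` of `ℚ(√−n)`: ramified classes and the class of `(√−n)` -/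

section Setup

variable {K : Type*} [Field K] [NumberField K] (h2 : finrank ℚ K = 2)
  {n : ℕ} {x : 𝓞 K} (hx : x ^ 2 = -(n : 𝓞 K))
  {t : ℕ} {p : Fin t → ℕ} (hp : ∀ i, (p i).Prime) (hinj : Function.Injective p)
  (hprod : ∏ i, p i = if n % 4 = 1 then 2 * n else n)
  {P : Fin t → Ideal (𝓞 K)} (hP : ∀ i, P i ^ 2 = span {(p i : 𝓞 K)})

omit [NumberField K] in
include hx in
/-- `x² = -n` read in `K`. [cite: LiMa2008, Lemma 0.1] -/
private theorem coe_sq_eq_neg : ((x : 𝓞 K) : K) ^ 2 = -(n : K) := by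
  have h := congrArg (fun y : 𝓞 K => (y : K)) hx
  simpa using h

omit [NumberField K] in
include hp hP in
/-- **`𝔭ⱼ + 2𝒪_K = 𝒪_K` for `pⱼ` odd**: the ramified prime above an odd `pⱼ` is prime to the conductor `2`,
so it defines an element of `I_K(2)`. [cite: Cox2013, §7.C (definition of I_K(f)) and Prop. 7.20] -/
theorem sup_span_two_eq_top_of_ne_two {j : Fin t} (hj : p j ≠ 2) :
    P j ⊔ Ideal.span {((2 : ℕ) : 𝓞 K)} = ⊤ := by
  have hcop : IsCoprime ((p j : ℕ) : ℤ) ((2 : ℕ) : ℤ) :=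
    Nat.isCoprime_iff_coprime.mpr ((Nat.coprime_primes (hp j) Nat.prime_two).mpr hj)
  have h := span_sup_eq_top_of_sub_mem (K := K) (α := (p j : 𝓞 K)) hcop
    (by rw [Int.cast_natCast, sub_self]; exact Submodule.zero_mem _)
  have hle : Ideal.span {(p j : 𝓞 K)} ⊔ Ideal.span {((2 : ℕ) : 𝓞 K)} ≤ P j ⊔ Ideal.span {((2 : ℕ) : 𝓞 K)} :=
    sup_le_sup_right ((Ideal.span_singleton_le_iff_mem _).mpr (natCast_mem hP j)) _
  rw [h] at hle
  exact top_le_iff.mp hle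

include h2 hx hp hinj hprod hP in
/-- **`∏_{pⱼ ∣ n} 𝔭ⱼ = (x)`**: for `pⱼ ∣ n` the ramified prime is `𝔭ⱼ = (pⱼ, x)` (uniqueness of the prime
above a ramified prime), and `∏_{p ∣ n} (p, x) = (x)`. [cite: Stevenhagen1995RedeiMatrices, §2]
[cite: LiMa2008, Lemma 0.1] -/
theorem prod_filter_dvd_eq_span :
    ∏ j ∈ Finset.univ.filter (fun j => p j ∣ n), P j = span {x} := by
  classical
  obtain ⟨hn, hn0⟩ := squarefree_and_pos_of_prod_eq hp hinj hprod
  have hPj : ∀ j, p j ∣ n → P j = span {(p j : 𝓞 K), x} := fun j hj => by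
    haveI := isMaximal_of_sq_eq_span h2 (hp j) (sq_span_pair_eq_span hn hx (hp j) hj)
    exact eq_of_sq_eq_span_of_mem h2 (hp j) (sq_span_pair_eq_span hn hx (hp j) hj)
      (isMaximal_of_sq_eq_span h2 (hp j) (hP j)).isPrime' (natCast_mem hP j)
  rw [← prod_span_pair_eq_span hn hx h2,
    Finset.prod_congr rfl fun j hj => hPj j (Finset.mem_filter.mp hj).2]
  refine Finset.prod_nbij (fun j => p j) (fun j hj => ?_) (fun j _ k _ h => hinj h) (fun q hq => ?_)
    (fun j _ => rfl)
  · exact Nat.mem_primeFactors.mpr ⟨hp j, (Finset.mem_filter.mp hj).2, hn0.ne'⟩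
  · obtain ⟨hq, hqn, -⟩ := Nat.mem_primeFactors.mp (Finset.mem_coe.mp hq)
    obtain ⟨j, rfl⟩ := exists_eq_of_prime_dvd hp hprod hq hqn
    exact ⟨j, Finset.mem_coe.mpr (Finset.mem_filter.mpr ⟨Finset.mem_univ j, hqn⟩), rfl⟩

include h2 hx hp hinj hprod in
/-- **`(√−n) ∉ P_{K,ℤ}(2)` for `n ≡ 1 (mod 4)`, `n ≠ 1`**: the principal ideal `x𝒪_K` (prime to `2`) is NOT
in the denominator group of the conductor-`2` ring class group, i.e. its class `[(x)] ∈ I_K(2)/P_{K,ℤ}(2)` is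
the non-trivial element of `ker(Pic(𝒪₂) → Cl(𝒪_K))`.  Proof: `x𝒪_K ∈ P_{K,ℤ}(2)` would give `x ≡ εa (mod 2𝒪_K)`
with `ε ∈ 𝒪_K^× = {±1}` and `a` odd (Cox (7.27), Exercise 7.30); writing `x = ±a + 2z`,
`−n = x² = a² + 4(±az + z²)`, so `4 ∣ n + a² ≡ 2 (mod 4)`. (In form language: `(n, 0, 4) ≁ (1, 0, 4n)`.)
[cite: Cox2013, §7.D (7.27) and Exercise 7.30] [cite: Buell1989, Prop. 4.17 (PDF p. 37–38: the ambiguous form (4, 0, Δ'/4) for Δ' ≡ 4 (mod 8))] -/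
theorem prin_sqrt_neg_not_mem_ringClassDen_two (hn4 : n % 4 = 1) (hn1 : n ≠ 1) (hx0 : x ≠ 0) :
    prin K x hx0 ∉ ringClassDen K 2 := by
  intro hmem
  obtain ⟨hn, hn0⟩ := squarefree_and_pos_of_prod_eq hp hinj hprod
  have hn3 : n ≠ 3 := by omega
  have hxK : ((x : 𝓞 K) : K) ^ 2 = -(n : K) := coe_sq_eq_neg hx
  obtain ⟨b, hb⟩ := exists_basis_zero_eq_one h2
  have hω := basis_one_mul_self_eq b hb
  -- `(x) + (2) = (1)`: `1 = -x² - 2k` for `n = 2k + 1`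
  have hk : (n : 𝓞 K) = 2 * ((n / 2 : ℕ) : 𝓞 K) + 1 := by
    have h : n = 2 * (n / 2) + 1 := by omega
    exact_mod_cast congrArg (fun m : ℕ => (m : 𝓞 K)) h
  have hcop : Ideal.span {x} ⊔ Ideal.span {((2 : ℕ) : 𝓞 K)} = ⊤ := by
    rw [Ideal.eq_top_iff_one]
    have h1 : (1 : 𝓞 K) = x * (-x) + ((2 : ℕ) : 𝓞 K) * (-((n / 2 : ℕ) : 𝓞 K)) := by
      have hx2 : x * x = -(n : 𝓞 K) := by rw [← sq, hx]
      push_cast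
      linear_combination hx2 - hk
    rw [h1]
    exact Submodule.add_mem _ (Ideal.mem_sup_left (Ideal.mul_mem_right _ _ (Ideal.mem_span_singleton_self x)))
      (Ideal.mem_sup_right (Ideal.mul_mem_right _ _ (Ideal.mem_span_singleton_self _)))
  obtain ⟨ε, a, ha, hεa⟩ := exists_units_int_of_prin_mem_ringClassDen b hb hω hx0 hcop hmem
  -- `ε = ±1`, so `ε² = 1`
  have hε2 : (ε : 𝓞 K) * (ε : 𝓞 K) = 1 := by
    rcases units_eq_one_or_neg_one h2 hn hxK hn1 hn3 ε with h | h <;> rw [h] <;> ring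
  -- `a` is odd
  have ha2 : ¬ (2 : ℤ) ∣ a := by
    rintro ⟨c, rfl⟩
    have h22 : IsCoprime (2 : ℤ) 2 := by
      have h' := ha.of_mul_left_left
      simpa using h'
    rcases Int.isUnit_iff.mp (isCoprime_self.mp h22) with h | h <;> omega
  obtain ⟨m, hm⟩ : ∃ m : ℤ, a = 2 * m + 1 := ⟨a / 2, by omega⟩
  -- `x = εa + 2z`, `x² = -n`: `-n - a² = 4(εaz + z²)`
  obtain ⟨z, hz⟩ := Ideal.mem_span_singleton'.mp hεa
  have hx2 : x * x = -(n : 𝓞 K) := by rw [← sq, hx]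
  have hkey : (((-(n : ℤ) - a ^ 2 : ℤ)) : 𝓞 K) =
      ((4 : ℕ) : 𝓞 K) * ((ε : 𝓞 K) * (a : 𝓞 K) * z + z * z) := by
    push_cast
    linear_combination (-1 : 𝓞 K) * hx2 + ((a : 𝓞 K) * (a : 𝓞 K)) * hε2 -
      (x + (ε : 𝓞 K) * (a : 𝓞 K) + 2 * z) * hz
  have hmem4 : (((-(n : ℤ) - a ^ 2 : ℤ)) : 𝓞 K) ∈ Ideal.span {((4 : ℕ) : 𝓞 K)} := by
    rw [hkey]
    exact Ideal.mul_mem_right _ _ (Ideal.mem_span_singleton_self _)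
  have h4 : ((4 : ℕ) : ℤ) ∣ -(n : ℤ) - a ^ 2 := (intCast_mem_span_iff b hb _).mp hmem4
  have hsq : a ^ 2 = 4 * (m * m + m) + 1 := by rw [hm]; ring
  rw [hsq] at h4
  have h4' : (4 : ℤ) ∣ -(n : ℤ) - 1 := by
    have h := dvd_add h4 (dvd_mul_right (4 : ℤ) (m * m + m))
    have e : -(n : ℤ) - (4 * (m * m + m) + 1) + 4 * (m * m + m) = -(n : ℤ) - 1 := by ring
    rw [e] at h
    exact_mod_cast h
  omega

end Setup

/-! ## §3 The count `#(Pic(𝒪₂)² ∩ Pic(𝒪₂)[2]) = #{e : RM(D)ᵀ e = 0, e₂ = 0}` -/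

section ConductorTwo

variable {K : Type} [Field K] [NumberField K] (h2 : finrank ℚ K = 2)
  {n : ℕ} {x : 𝓞 K} (hx : x ^ 2 = -(n : 𝓞 K))
  {t : ℕ} {p : Fin t → ℕ} (hp : ∀ i, (p i).Prime) (hinj : Function.Injective p)
  (hprod : ∏ i, p i = if n % 4 = 1 then 2 * n else n)
  {P : Fin t → Ideal (𝓞 K)} (hP : ∀ i, P i ^ 2 = span {(p i : 𝓞 K)})

include h2 hx hp hinj hprod hP in
/-- **Rédei–Reichardt for the order of conductor `2`** (`K ∋ x = √−n`, `n ≡ 1 (mod 4)` square-free, `n ≠ 1`,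
`p₁ ⋯ p_t = 2n` the primes of `d_K = −4n`, `p_{i₂} = 2`, `𝔭ᵢ² = (pᵢ)`; `κ ≠ 1` a square generating
`ker(Pic(𝒪₂) → Cl(𝒪_K))`):
`#(Pic(𝒪₂)² ∩ Pic(𝒪₂)[2]) = #{e ∈ 𝔽₂^t : RM(D)ᵀ e = 0 ∧ e_{i₂} = 0}`, i.e.
`2^{r₄(C(−16n))}` is the number of Rédei-kernel vectors vanishing at the prime `2` — Stevenhagen's proof of
the `4`-rank formula run inside `Pic(𝒪₂) = I_K(2)/P_{K,ℤ}(2)`, where the ambiguous classes are the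
`∏_{pⱼ odd} [𝔭ⱼ]^{eⱼ}` (bijectively: the only relation `∏_{p ∣ n} 𝔭_p = (√−n)` of `Cl(𝒪_K)` is broken,
`(√−n) ∉ P_{K,ℤ}(2)`), and squares are detected in `Cl(𝒪_K)` (`κ ∈ Pic(𝒪₂)²`).
[cite: Stevenhagen1995RedeiMatrices, §2 Thm. 1 (proof)] [cite: LiMa2008, Def. 0.2 and Thm. 0.4]
[cite: Cox2013, §7.C Prop. 7.22 and §7.D Thm. 7.24, (7.25)–(7.27)]
[cite: Buell1989, Thm. 4.16, Prop. 4.17, Thm. 4.21 (PDF pp. 37–40)] -/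
theorem fourTwoCard_ringClassGroup_two_eq_card (hn4 : n % 4 = 1) (hn1 : n ≠ 1) {i₂ : Fin t}
    (hi₂ : p i₂ = 2) {κ : RingClassGroup K 2} (hκ : toClassGroup K 2 κ = 1) (hκ1 : κ ≠ 1)
    (hκsq : IsSquare κ) :
    fourTwoCard (RingClassGroup K 2) =
      Fintype.card {e : Fin t → ZMod 2 // (redeiMatrix n p)ᵀ *ᵥ e = 0 ∧ e i₂ = 0} := by
  classical
  obtain ⟨hn, hn0⟩ := squarefree_and_pos_of_prod_eq hp hinj hprod
  have hn3 : n ≠ 3 := by omega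
  have h2ndvd : ¬ 2 ∣ n := by omega
  have hxK : ((x : 𝓞 K) : K) ^ 2 = -(n : K) := coe_sq_eq_neg hx
  have hx0 : x ≠ 0 := by
    rintro rfl
    rw [zero_pow two_ne_zero, eq_comm, neg_eq_zero, Nat.cast_eq_zero] at hx
    omega
  -- the discriminant `d_K = -4n` is even, `≠ -4`, negative
  have hdisc : NumberField.discr K = -4 * n := by rw [discr_eq h2 hn hxK, if_neg (by omega)]
  have hd : NumberField.discr K < 0 := by rw [hdisc]; omega
  have heven : Even (NumberField.discr K) := ⟨-2 * n, by rw [hdisc]; ring⟩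
  have hd4 : NumberField.discr K ≠ -4 := by rw [hdisc]; omega
  haveI : Finite (RingClassGroup K 2) := finite_ringClassGroup (K := K) h2 two_ne_zero
  -- the extension `1 → {1, κ} → Pic(𝒪₂) → Cl(𝒪_K) → 1`
  have hπ : Function.Surjective (toClassGroup K 2) := toClassGroup_surjective_of_discr_neg h2 hd two_ne_zero
  have hker : ∀ g, toClassGroup K 2 g = 1 ↔ g = 1 ∨ g = κ := toClassGroup_two_eq_one_iff h2 hd heven hd4 hκ hκ1
  -- §a `#Pic(𝒪₂)[2] = #Cl[2] = 2^{t-1}`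
  have htors : Nat.card {g : RingClassGroup K 2 // g ^ 2 = 1} = 2 ^ (t - 1) := by
    rw [natCard_sq_eq_one_eq_of_ker_pair (G := RingClassGroup K 2) (C := ClassGroup (𝓞 K))
      (toClassGroup K 2) hπ hker hκ1 hκsq, natCard_sq_eq_one_eq h2 hx hp hinj hprod]
  -- §b the lifted ramified classes `yⱼ = [𝔭ⱼ] ∈ Pic(𝒪₂)` (`pⱼ` odd), `y_{i₂} = 1`
  have hP0 : ∀ j, P j ∈ (Ideal (𝓞 K))⁰ := fun j => mem_nonZeroDivisors_of_sq_eq_span h2 (hp j) (hP j)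
  have hPne : ∀ j, P j ≠ ⊥ := fun j => nonZeroDivisors.ne_zero (hP0 j)
  have hne2 : ∀ j, p j ∣ n → p j ≠ 2 := fun j hj h2j => h2ndvd (h2j ▸ hj)
  obtain ⟨u, hu2, huP⟩ : ∃ u : Fin t → (FractionalIdeal (𝓞 K)⁰ K)ˣ,
      (∀ j, p j = 2 → u j = 1) ∧ (∀ j, p j ≠ 2 → u j = FractionalIdeal.mk0 K ⟨P j, hP0 j⟩) :=
    ⟨fun j => if p j = 2 then 1 else FractionalIdeal.mk0 K ⟨P j, hP0 j⟩, fun j hj => if_pos hj,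
      fun j hj => if_neg hj⟩
  have hu : ∀ j, u j ∈ ringClassNum K 2 := fun j => by
    by_cases hj : p j = 2
    · rw [hu2 j hj]; exact Subgroup.one_mem _
    · rw [huP j hj]; exact mk0_mem_ringClassNum (sup_span_two_eq_top_of_ne_two hp hP hj) (hPne j)
  -- `𝔭ⱼ² = pⱼ𝒪_K ∈ P_{K,ℤ}(2)` for `pⱼ` odd
  have hpj0 : ∀ j, (p j : 𝓞 K) ≠ 0 := fun j => Nat.cast_ne_zero.mpr (hp j).ne_zero
  have husq : ∀ j, p j ≠ 2 → u j ^ 2 = prin K (p j : 𝓞 K) (hpj0 j) := fun j hj => by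
    rw [huP j hj]
    ext1
    rw [Units.val_pow_eq_pow_val, FractionalIdeal.coe_mk0, coe_prin']
    change ((P j : Ideal (𝓞 K)) : FractionalIdeal (𝓞 K)⁰ K) ^ 2 = _
    rw [← FractionalIdeal.coeIdeal_pow, hP j]
  have husq_mem : ∀ j, u j ^ 2 ∈ ringClassDen K 2 := fun j => by
    by_cases hj : p j = 2
    · rw [hu2 j hj, one_pow]; exact Subgroup.one_mem _
    · rw [husq j hj]
      refine prin_mem_ringClassDen (hpj0 j) (a := (p j : ℤ))
        (Nat.isCoprime_iff_coprime.mpr ((Nat.coprime_primes (hp j) Nat.prime_two).mpr hj)) ?_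
      rw [Int.cast_natCast, sub_self]
      exact Submodule.zero_mem _
  -- the quotient map `q : I_K(2) → Pic(𝒪₂)` and the classes `yⱼ`
  obtain ⟨q, hq⟩ : ∃ q : ringClassNum K 2 →* RingClassGroup K 2, ∀ s, q s = QuotientGroup.mk s :=
    ⟨QuotientGroup.mk' _, fun s => rfl⟩
  have hq1 : ∀ s : ringClassNum K 2, q s = 1 ↔ (s : (FractionalIdeal (𝓞 K)⁰ K)ˣ) ∈ ringClassDen K 2 :=
    fun s => by rw [hq, QuotientGroup.eq_one_iff, Subgroup.mem_subgroupOf]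
  obtain ⟨y, hy⟩ : ∃ y : Fin t → RingClassGroup K 2, ∀ j, y j = q ⟨u j, hu j⟩ := ⟨_, fun j => rfl⟩
  have hysq : ∀ j, y j ^ 2 = 1 := fun j => by
    rw [hy, ← map_pow, hq1]
    exact husq_mem j
  have hπy : ∀ j, p j ≠ 2 → toClassGroup K 2 (y j) = ClassGroup.mk0 ⟨P j, hP0 j⟩ := fun j hj => by
    rw [hy, hq, toClassGroup_mk]
    change ClassGroup.mk K (u j) = _
    rw [huP j hj, ClassGroup.mk_mk0]
  have hymod : ∀ j (m : ℕ), y j ^ m = y j ^ (m % 2) := fun j m => by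
    conv_lhs => rw [← Nat.mod_add_div m 2, pow_add, pow_mul, hysq j, one_pow, mul_one]
  -- §c the homomorphism `ψ(e) = ∏ yⱼ^{eⱼ}`
  obtain ⟨ψ, hψ⟩ : ∃ ψ : (Fin t → ZMod 2) → RingClassGroup K 2, ∀ e, ψ e = ∏ j, y j ^ (e j).val :=
    ⟨_, fun e => rfl⟩
  have hψadd : ∀ e e', ψ (e + e') = ψ e * ψ e' := fun e e' => by
    rw [hψ, hψ, hψ, ← Finset.prod_mul_distrib]
    refine Finset.prod_congr rfl fun j _ => ?_
    rw [Pi.add_apply, ZMod.val_add, ← hymod, pow_add]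
  have hψsq : ∀ e, ψ e ^ 2 = 1 := fun e => by
    rw [hψ, ← Finset.prod_pow]
    exact Finset.prod_eq_one fun j _ => by rw [← pow_mul, mul_comm, pow_mul, hysq, one_pow]
  have hπψ : ∀ e : Fin t → ZMod 2, e i₂ = 0 →
      toClassGroup K 2 (ψ e) = ∏ j, ClassGroup.mk0 ⟨P j, hP0 j⟩ ^ (e j).val := fun e he => by
    rw [hψ, map_prod]
    refine Finset.prod_congr rfl fun j _ => ?_
    rw [map_pow]
    by_cases hj : p j = 2
    · have hji : j = i₂ := hinj (hj.trans hi₂.symm)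
      subst hji
      rw [he, ZMod.val_zero, pow_zero, pow_zero]
    · rw [hπy j hj]
  -- §d `ψ` is injective on `E = {e : e_{i₂} = 0}`: kernel analysis
  have hψker : ∀ e : Fin t → ZMod 2, e i₂ = 0 → ψ e = 1 → e = 0 := by
    intro e he h1
    have hcl : ∏ j, ClassGroup.mk0 ⟨P j, hP0 j⟩ ^ (e j).val = 1 := by rw [← hπψ e he, h1, map_one]
    have hprinc : (∏ i, P i ^ (e i).val).IsPrincipal := by
      simp only [← map_pow, ← map_prod] at hcl
      rw [ClassGroup.mk0_eq_one_iff] at hcl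
      convert hcl using 2
      simp
    rcases eq_zero_or_eq_indicator_of_isPrincipal h2 hx hp hinj hprod hP hn1 hn3 e hprinc with h0 | hr
    · exact h0
    · -- `e = r`: `ψ(r) = [(x)] ≠ 1` in `Pic(𝒪₂)`
      exfalso
      have hval1 : ∀ j, (e j).val = if p j ∣ n then 1 else 0 := fun j => by
        rw [hr]
        show (if p j ∣ n then (1 : ZMod 2) else 0).val = _
        split_ifs <;> rfl
      have hψe : ψ e = q (∏ j ∈ Finset.univ.filter (fun j => p j ∣ n), ⟨u j, hu j⟩) := by
        rw [hψ, map_prod]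
        have hj' : ∀ j ∈ (Finset.univ : Finset (Fin t)),
            y j ^ (e j).val = if p j ∣ n then q ⟨u j, hu j⟩ else 1 := fun j _ => by
          rw [hval1 j, hy j]
          split_ifs <;> simp
        rw [Finset.prod_congr rfl hj', Finset.prod_filter]
      have hden : ((∏ j ∈ Finset.univ.filter (fun j => p j ∣ n), (⟨u j, hu j⟩ : ringClassNum K 2) :
          ringClassNum K 2) : (FractionalIdeal (𝓞 K)⁰ K)ˣ) ∈ ringClassDen K 2 := by
        rw [← hq1, ← hψe, h1]
      have hval : ((∏ j ∈ Finset.univ.filter (fun j => p j ∣ n), (⟨u j, hu j⟩ : ringClassNum K 2) :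
          ringClassNum K 2) : (FractionalIdeal (𝓞 K)⁰ K)ˣ) = prin K x hx0 := by
        rw [SubmonoidClass.coe_finsetProd]
        have hj' : ∀ j ∈ Finset.univ.filter (fun j => p j ∣ n),
            ((⟨u j, hu j⟩ : ringClassNum K 2) : (FractionalIdeal (𝓞 K)⁰ K)ˣ) =
              FractionalIdeal.mk0 K ⟨P j, hP0 j⟩ :=
          fun j hj => huP j (hne2 j (Finset.mem_filter.mp hj).2)
        rw [Finset.prod_congr rfl hj', ← map_prod]
        ext1
        rw [FractionalIdeal.coe_mk0, coe_prin', Submonoid.coe_finsetProd]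
        simp only []
        rw [prod_filter_dvd_eq_span h2 hx hp hinj hprod hP]
      rw [hval] at hden
      exact prin_sqrt_neg_not_mem_ringClassDen_two h2 hx hp hinj hprod hn4 hn1 hx0 hden
  -- §e `ψ : E → Pic(𝒪₂)[2]` is a bijection
  have hE : Nat.card {e : Fin t → ZMod 2 // e i₂ = 0} = 2 ^ (t - 1) := by
    have ht : 0 < t := Fin.pos i₂
    let ev : (Fin t → ZMod 2) →+ ZMod 2 := Pi.evalAddMonoidHom (fun _ => ZMod 2) i₂
    have hsurj : Function.Surjective ev := fun c => ⟨Pi.single i₂ c, by simp [ev]⟩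
    have hmul : Nat.card ev.ker * Nat.card ev.range = 2 ^ t := by
      rw [← AddSubgroup.index_ker, AddSubgroup.card_mul_index, Nat.card_fun, Nat.card_zmod,
        Nat.card_eq_fintype_card, Fintype.card_fin]
    have hrange : Nat.card ev.range = 2 := by
      rw [AddMonoidHom.range_eq_top.mpr hsurj, AddSubgroup.card_top, Nat.card_zmod]
    have hkerE : Nat.card ev.ker = Nat.card {e : Fin t → ZMod 2 // e i₂ = 0} :=
      Nat.card_congr (Equiv.subtypeEquivRight fun e => by rw [AddMonoidHom.mem_ker]; rfl)
    rw [hrange, hkerE] at hmul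
    have h2t : 2 ^ t = 2 ^ (t - 1) * 2 := by rw [← pow_succ]; congr 1; omega
    rw [h2t] at hmul
    exact Nat.eq_of_mul_eq_mul_right two_pos hmul
  set Ψ : {e : Fin t → ZMod 2 // e i₂ = 0} → {g : RingClassGroup K 2 // g ^ 2 = 1} :=
    fun e => ⟨ψ e.1, hψsq e.1⟩ with hΨdef
  have hΨinj : Function.Injective Ψ := by
    intro e e' hee'
    have h : ψ e.1 = ψ e'.1 := by simpa [hΨdef] using congrArg Subtype.val hee'
    have hsum : ψ (e.1 + e'.1) = 1 := by rw [hψadd, h, ← pow_two, hψsq]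
    have h0 := hψker (e.1 + e'.1) (by rw [Pi.add_apply, e.2, e'.2, add_zero]) hsum
    apply Subtype.ext
    funext j
    have hj := congr_fun h0 j
    rw [Pi.add_apply, Pi.zero_apply, add_eq_zero_iff_eq_neg, ZMod.neg_eq_self_mod_two] at hj
    exact hj
  have hΨbij : Function.Bijective Ψ := hΨinj.bijective_of_nat_card_le (by rw [htors, hE])
  -- §f squares: `ψ(e) ∈ Pic(𝒪₂)²` iff `RM(D)ᵀ e = 0`
  have hsqiff : ∀ e : Fin t → ZMod 2, e i₂ = 0 →
      (IsSquare (ψ e) ↔ (redeiMatrix n p)ᵀ *ᵥ e = 0) := by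
    intro e he
    rw [isSquare_iff_isSquare_map_of_ker_pair (G := RingClassGroup K 2) (C := ClassGroup (𝓞 K))
      (toClassGroup K 2) hπ hker hκsq (ψ e), hπψ e he, isSquare_prod_pow_iff h2 hx hp hinj hprod hP e]
    have hrow : ∀ i, p i ≠ 2 →
        (∑ j, (if (if j = i then jacobiSym ((n / p i : ℕ) : ℤ) (p i) else jacobiSym (p j) (p i)) = -1
            then (1 : ZMod 2) else 0) * e j) = ∑ j, redeiMatrix n p j i * e j := fun i hi2 =>
      Finset.sum_congr rfl fun j _ => by rw [redeiMatrix_transpose_apply hp hinj hprod hi2 j]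
    constructor
    · intro h
      ext i
      rw [Matrix.mulVec, dotProduct, Pi.zero_apply]
      simp only [Matrix.transpose_apply]
      exact forall_sum_eq_zero_of_odd hinj n e (fun k hk2 => (hrow k hk2) ▸ h k hk2) i
    · intro h i hi2
      rw [hrow i hi2]
      have := congr_fun h i
      rw [Matrix.mulVec, dotProduct, Pi.zero_apply] at this
      simpa only [Matrix.transpose_apply] using this
  -- §g count
  rw [fourTwoCard_def, ← Nat.card_eq_fintype_card]
  symm
  refine Nat.card_eq_of_bijective
    (fun e => ⟨ψ e.1, (hsqiff e.1 e.2.2).mpr e.2.1, hψsq e.1⟩) ⟨fun e e' hee' => ?_, fun g => ?_⟩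
  · have h : Ψ ⟨e.1, e.2.2⟩ = Ψ ⟨e'.1, e'.2.2⟩ := Subtype.ext (by
      simpa [hΨdef] using congrArg Subtype.val hee')
    exact Subtype.ext (by simpa using congrArg Subtype.val (hΨinj h))
  · obtain ⟨e, he⟩ := hΨbij.2 ⟨g.1, g.2.2⟩
    have hψe : ψ e.1 = g.1 := by simpa [hΨdef] using congrArg Subtype.val he
    refine ⟨⟨e.1, (hsqiff e.1 e.2).mp (hψe ▸ g.2.1), e.2⟩, Subtype.ext ?_⟩
    simpa using hψe

/-- **The same count for a field given as `ℚ(√−n)`** (`IsQuadraticFieldOfSqrt K (−n)`: `[K:ℚ] = 2` and `−n` is a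
square in `K`): the ramified primes are chosen inside the proof (`exists_sq_eq_span`), so the statement only
mentions `n`, the prime tuple, the index of `2`, and the kernel class `κ`.
[cite: Stevenhagen1995RedeiMatrices, §2 Thm. 1 (proof)] [cite: Cox2013, §7.D Thm. 7.24, (7.25)–(7.27)]
[cite: Buell1989, Prop. 4.17 and Thm. 4.21 (PDF pp. 37–40)] -/
theorem fourTwoCard_ringClassGroup_two_eq_card_of_isQuadraticFieldOfSqrt {n t : ℕ} {p : Fin t → ℕ}
    (hp : ∀ i, (p i).Prime) (hinj : Function.Injective p) (hprod : ∏ i, p i = if n % 4 = 1 then 2 * n else n)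
    (hn4 : n % 4 = 1) (hn1 : n ≠ 1) {i₂ : Fin t} (hi₂ : p i₂ = 2) (K : Type) [Field K] [NumberField K]
    (hK : IsQuadraticFieldOfSqrt K (-(n : ℤ))) {κ : RingClassGroup K 2} (hκ : toClassGroup K 2 κ = 1)
    (hκ1 : κ ≠ 1) (hκsq : IsSquare κ) :
    fourTwoCard (RingClassGroup K 2) =
      Fintype.card {e : Fin t → ZMod 2 // (redeiMatrix n p)ᵀ *ᵥ e = 0 ∧ e i₂ = 0} := by
  obtain ⟨h2, x₀, hx₀⟩ := hK
  have hxK : x₀ ^ 2 = -(n : K) := by rw [hx₀]; push_cast; ring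
  obtain ⟨x, -, hx⟩ := exists_ringOfIntegers_sq_eq_neg hxK
  choose P hP using exists_sq_eq_span hx hp hinj hprod
  exact fourTwoCard_ringClassGroup_two_eq_card h2 hx hp hinj hprod hP hn4 hn1 hi₂ hκ hκ1 hκsq

end ConductorTwo

end Literature.NumberTheory.QuadraticFields.RedeiReichardt

end
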